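import Summits.FinalStateConjecture.FinalStateConjecture.Theorems.BartnikGapSettlingCaptureStubPhantomSuccAux
import HarnessLib

/-!
# Stub `stub_phantomSucc` of line `Sketch` of crux `Capture` (stmt-FinalStateConjecture-10115):
# the phantom hole at every hole count

The crux `Capture` (routes `BartnikGapSettling` / `QuietWindowCapture`, summit
`FinalStateConjecture`) is stated over `CauchyDevelopment.IsNearKerrLeaf 𝒟 k ε N M a S`
(`Literature/Geometry/Lorentzian/NearKerrLeaf.lean`: `N` hole charts on boosted Kerr star regions,
one flat hyperboloidal chart, twenty clauses).  This file proves the registered stub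
`stub_phantomSucc` of the line skeleton
`Summits/FinalStateConjecture/FinalStateConjecture/Cruxes/Capture/Lines/Sketch.lean` (PHANTOM
HOLE AT EVERY HOLE COUNT, generalising the landed `N = 0` case `stub_phantom` of
`BartnikGapSettlingCaptureStubPhantom.lean`): an `N`-hole `(ε, k)`-near-Kerr leaf `S` is an
`(N + 1)`-hole `(ε, k)`-near-Kerr leaf with the SAME `S`, the old labels shifted to the indices
`Fin.succ i` and one new Schwarzschild label `(M', 0)`, `M' > 0`, at index `0` (`Matrix.vecCons`):
hole labels are upper information only.

Construction.  Keep the flat chart `Ψ₀ : U₀ → 𝒟`, all old hole charts and all their clauses.  The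
phantom hole has the unboosted motion `(1, c')`, `c' = (0, ξ)` a pure spatial translation, so its
star background is `{M' < |y̲ − ξ|}` with time `y⁰` and radius `|y̲ − ξ|`
(`Kerr.radius 0 = |·̲|`); truncation radius `R := M'`, overlap radius `ρ := M'/2`.  Its disc
`{t* = 0, r ≤ M'}`, upper layer and inner overlap annulus are EMPTY in the star domain
`{r > M'}`, so the deviation clause (`supCkENorm ∅ = 0`), its part in the pairwise disjointness,
the first overlap clause and the three clauses on `S`, `I⁺(S)` and the barrier (unions over
`Fin (N + 1)` whose `0`-th member is `∅`) reduce to the old ones.  The phantom chart is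
`Ψ_new := Ψ₀ ∘ π ∘ e`, `π` the extension-by-junk of the identity of `U₀` and `e` the translated
bending map of the helper file (`BartnikGapSettlingCaptureStubPhantomSuccAux.lean`,
`exists_bend`): a smooth open embedding of the layer `{−1 < y⁰ < 1, M' < |y̲ − ξ| < M' + 1}`
with hyperboloidal time `t₀(e y) = y⁰` and values in the ball `{|x̲ − ξ| < 5M'/4}`, charting the
cap `{t₀ = 0, M'/2 < |x̲ − ξ| < M'}` (second overlap clause).  NEW for `N ≥ 1` is the PLACEMENT
of `ξ`: `U₀` is only known to contain
`{t₀ > −1, rᵢ > ρᵢ ∀ i}`, so the bent layer must avoid the old excised tubes `{rᵢ ≤ ρᵢ}`; by the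
helper's `stub_phantomSuccTube` each tube meets the hyperboloidal layer `{−1 < t₀ < 1}` in
a bounded set `{‖x‖ ≤ Dᵢ}`, and `ξ := (|D| + 2M') e₁` with `D ≥ Dᵢ` puts the ball
`{|x̲ − ξ| < 2M'} ∩ {−1 < t₀ < 1}` outside every tube, hence inside `U₀` and inside the flat layer
`L₀`.  The dependent families of charts and layers over `Fin (N + 1)` are `Fin.cases` of the new
and the old ones (definitionally `Matrix.vecCons` on the non-dependent data).

Log (worker, 2026-08-16): helper file landed first (p110726: bending map with centre, bounded
tube sections = registered sub-goal `stub_phantomSuccTube`, `Fin (N+1)` bookkeeping); this file is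
the assembly of the twenty clauses along the landed `N = 0` template.

References: Dafermos–Holzegel–Rodnianski–Taylor arXiv:2104.08222, §1 (leaf vocabulary);
Dafermos–Rodnianski arXiv:0811.0354, §5.1 (Kerr-star coordinates); O'Neill 1983, Ch. 9 (`O(1,3)`);
the hyperboloids `{x⁰ − √(1 + |x̲|²) = τ}` of Minkowski space are folklore.
-/

-- the doubled `FinalStateConjecture.FinalStateConjecture` path component trips dupNamespace
set_option linter.dupNamespace false

noncomputable section

namespace Summit.FinalStateConjecture.FinalStateConjecture.Theorems.BartnikGapSettling.Capture

open Set Filter Topology TopologicalSpace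
open scoped Manifold ContDiff ENNReal
open Literature.Geometry.Lorentzian
open PhantomSucc

/-- **The phantom hole at every hole count** (stub `stub_phantomSucc` of line `Sketch`, crux
`Capture`, stmt-FinalStateConjecture-10115): every `N`-hole `(ε, k)`-near-Kerr leaf `S` of a
Cauchy development is an `(N + 1)`-hole `(ε, k)`-near-Kerr leaf with the same `S`, the old labels
at the indices `Fin.succ i` and the Schwarzschild label `(M', 0)`, `M' > 0`, at index `0`.  The
phantom hole is an unboosted star background centred far out on the hyperboloidal leaf (beyond the
bounded sections of the old excised tubes), with truncation radius `M'` (empty disc, vacuous metric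
duties), overlap radius `M'/2`, and chart `Ψ₀ ∘ e`, `e` the translated bending map, which charts
the cap `Ψ₀ {t₀ = 0, M'/2 < |x̲ − ξ| < M'}` of the hyperboloidal leaf. [folklore] -/
theorem stub_phantomSucc :
    ∀ (X : Type) [TopologicalSpace X] [ChartedSpace E3 X] [IsManifold (𝓡 3) ∞ X] [ConnectedSpace X]
      (D : InitialDataSet (𝓡 3) X) (𝒟 : CauchyDevelopment D) (k : ℕ) (ε : ℝ≥0∞) (N : ℕ)
      (M a : Fin N → ℝ) (S : Set 𝒟.carrier) (M' : ℝ), 0 < M' →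
      𝒟.IsNearKerrLeaf k ε N M a S →
        𝒟.IsNearKerrLeaf k ε (N + 1) (Matrix.vecCons M' M) (Matrix.vecCons 0 a) S := by
  intro X _ _ _ _ D 𝒟 k ε N M a S M' hM' h
  obtain ⟨R, ρ, mo, r, B, U₀, B₀, Ψ, Ψ₀, L, W, L₀, W₀, hr, hB, hB₀, hLW, hL₀, hW₀, hpar, hU₀, hΨ,
    hΨ₀, hΨ₀e, hΨ₀J, hdev, hdev₀, hdisj, hov₁, hov₂, hS, hWI, hbar⟩ := h
  subst hB₀
  /- 1. Placement: the old excised tubes `{rᵢ ≤ ρᵢ}` have bounded sections in the hyperboloidal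
  layer, so for a far centre `ξ` the ball `{|x̲ - ξ| < 2M'}` of the layer lies in `U₀`. -/
  choose Dt hDt using fun i : Fin N ↦ stub_phantomSuccTube (mo i).1 (mo i).2 (a i) (ρ i)
  obtain ⟨D', hD'⟩ : ∃ D' : ℝ, ∀ i, Dt i ≤ D' := by
    obtain ⟨D', hD'⟩ := (finite_range Dt).bddAbove
    exact ⟨D', fun i ↦ hD' ⟨i, rfl⟩⟩
  obtain ⟨ξ, hξn⟩ : ∃ ξ : E3, ‖ξ‖ = |D'| + 2 * M' :=
    ⟨(|D'| + 2 * M') • EuclideanSpace.single 0 1, by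
      rw [norm_smul, PiLp.norm_single, norm_one, mul_one, Real.norm_of_nonneg (by positivity)]⟩
  have hfar : ∀ x : E4, -1 < x 0 - √(1 + E4.spatialNorm x ^ 2) →
      x 0 - √(1 + E4.spatialNorm x ^ 2) < 1 → ‖E4.spatial x - ξ‖ < 2 * M' →
        x ∈ (U₀ : Set E4) := by
    intro x h1 h2 h3
    refine hU₀ ⟨h1, fun i ↦ ?_⟩
    by_contra hle
    have hle' : Kerr.radius (a i) (poincareInv (mo i).1 (mo i).2 x) ≤ ρ i := by
      have h := not_lt.1 hle
      rwa [hr i] at h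
    have h4 := (abs_apply_zero_le_norm_and_spatialNorm_le_norm x).2
    have h5 : E4.spatialNorm x = ‖E4.spatial x‖ := rfl
    linarith [hDt i x hle' h1 h2, le_abs_self D', hD' i, norm_le_norm_add_norm_sub (E4.spatial x) ξ]
  have ht₀c : Continuous fun x : E4 ↦ x 0 - √(1 + E4.spatialNorm x ^ 2) := by
    unfold E4.spatialNorm; fun_prop
  have hL₀o : IsOpen L₀ := by
    rw [hL₀]
    simp only [hypBackground_time]
    exact (isOpen_lt continuous_const (ht₀c.comp continuous_subtype_val)).and
      (isOpen_lt (ht₀c.comp continuous_subtype_val) continuous_const)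
  -- a junk point of `U₀` and the extension-by-junk `π : E4 → U₀` of the identity of `U₀`
  have hx₀ : E4.ofTimeSpace (√(1 + ‖ξ‖ ^ 2)) ξ ∈ (U₀ : Set E4) :=
    hfar _ (by rw [E4.ofTimeSpace_apply_zero, E4.spatialNorm_ofTimeSpace, sub_self]; norm_num)
      (by rw [E4.ofTimeSpace_apply_zero, E4.spatialNorm_ofTimeSpace, sub_self]; norm_num)
      (by rw [E4.spatial_ofTimeSpace, sub_self, norm_zero]; positivity)
  obtain ⟨π, hπ⟩ : ∃ π : E4 → (hypBackground U₀).domain,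
      ∀ (x : E4) (hx : x ∈ (U₀ : Set E4)), π x = ⟨x, hx⟩ := by
    classical
    exact ⟨fun x ↦ if hx : x ∈ (U₀ : Set E4) then ⟨x, hx⟩ else ⟨_, hx₀⟩, fun x hx ↦ dif_pos hx⟩
  /- 2. The bending partial homeomorphism centred at `ξ`. -/
  obtain ⟨e, hsrc, htime, hball, hsmooth, htgt⟩ := exists_bend hM' ξ
  /- 3. The phantom background: motion `(1, (0, ξ))`, label `(M', 0)`, radius `|y̲ - ξ|`. -/
  obtain ⟨c', hc'⟩ : ∃ c' : E4, c' = E4.ofTimeSpace 0 ξ := ⟨_, rfl⟩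
  have poincareInv_one : ∀ x, poincareInv 1 c' x = x - c' := fun x ↦ rfl
  have hrad₀ : ∀ x, Kerr.radius 0 (poincareInv 1 c' x) = ‖E4.spatial x - ξ‖ := fun x ↦ by
    rw [poincareInv_one, Kerr.radius_zero_left, E4.spatialNorm, map_sub, hc',
      E4.spatial_ofTimeSpace]
  obtain ⟨r₁, hr₁⟩ : ∃ r₁ : E4 → ℝ, r₁ = fun x ↦ Kerr.radius 0 (poincareInv 1 c' x) := ⟨_, rfl⟩
  have hr₁' : ∀ x, r₁ x = ‖E4.spatial x - ξ‖ := fun x ↦ by rw [hr₁]; exact hrad₀ x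
  obtain ⟨B₁, hB₁⟩ : ∃ B₁ : ModelBackground, B₁ = starBackground 1 c' M' 0 r₁ := ⟨_, rfl⟩
  have hB₁t (x) : B₁.time x = x 0 := by
    rw [hB₁, starBackground_time, poincareInv_one, hc']
    simp
  have hB₁r (x) : B₁.radius x = ‖E4.spatial x - ξ‖ := by rw [hB₁, starBackground_radius, hr₁']
  have hB₁d : ∀ x, x ∈ B₁.domain ↔ M' < ‖E4.spatial x - ξ‖ := fun x ↦ by
    rw [hB₁, mem_starBackground_domain, Kerr.mem_region, hrad₀, max_eq_left hM'.le]
  have hrad : ∀ z : B₁.domain, ¬B₁.radius z.1 ≤ M' := fun z ↦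
    not_le.2 ((hB₁r z.1).symm ▸ (hB₁d _).1 z.2)
  obtain ⟨L₁, hL₁⟩ : ∃ L₁ : Set B₁.domain,
      L₁ = {x | -1 < B₁.time x.1 ∧ B₁.time x.1 < 1 ∧ B₁.radius x.1 < M' + 1} := ⟨_, rfl⟩
  obtain ⟨W₁, hW₁⟩ : ∃ W₁ : Set B₁.domain,
      W₁ = {x | 0 < B₁.time x.1 ∧ B₁.time x.1 < 1 ∧ B₁.radius x.1 ≤ M'} := ⟨_, rfl⟩
  have memL₁ : ∀ z : B₁.domain, z ∈ L₁ ↔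
      -1 < z.1 0 ∧ z.1 0 < 1 ∧ ‖E4.spatial z.1 - ξ‖ < M' + 1 := fun z ↦ by
    rw [hL₁, mem_setOf_eq, hB₁t, hB₁r]
  have srcL₁ : ∀ z : B₁.domain, z ∈ L₁ → z.1 ∈ e.source := fun z hz ↦
    have h := (memL₁ z).1 hz
    (hsrc _).2 ⟨h.1, h.2.1, (hB₁d _).1 z.2, h.2.2⟩
  -- the empty pieces: upper layer, disc and near zone of the phantom hole
  have hW₁e : W₁ = ∅ := eq_empty_of_forall_notMem fun z hz ↦ by
    rw [hW₁] at hz; exact hrad z hz.2.2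
  have hT₁e : B₁.truncTimeSlab M' 0 = ∅ := eq_empty_of_forall_notMem fun z hz ↦
    hrad z (ModelBackground.mem_truncTimeSlab.1 hz).2
  /- 4. The phantom chart `Ψ₁ = Ψ₀ ∘ π ∘ e`. -/
  obtain ⟨Ψ₁, hΨ₁⟩ : ∃ Ψ₁ : B₁.domain → 𝒟.carrier, Ψ₁ = fun z ↦ Ψ₀ (π (e z.1)) := ⟨_, rfl⟩
  have hmaps : ∀ z : B₁.domain, z ∈ L₁ → e z.1 ∈ (U₀ : Set E4) ∧ π (e z.1) ∈ L₀ := fun z hz ↦ by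
    obtain ⟨h1, h2, -⟩ := (memL₁ z).1 hz
    have hU : e z.1 ∈ (U₀ : Set E4) := hfar _ (by rw [htime]; exact h1)
      (by rw [htime]; exact h2) (by linarith [hball _ (srcL₁ z hz)])
    refine ⟨hU, ?_⟩
    rw [hπ _ hU, hL₀, mem_setOf_eq, hypBackground_time, htime]
    exact ⟨h1, h2⟩
  have hL₁o : IsOpen L₁ := by
    have h0c : Continuous fun z : B₁.domain ↦ z.1 0 :=
      (show Continuous fun x : E4 ↦ x 0 by fun_prop).comp continuous_subtype_val
    have hdc : Continuous fun z : B₁.domain ↦ ‖E4.spatial z.1 - ξ‖ :=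
      ((E4.spatial.continuous.comp continuous_subtype_val).sub continuous_const).norm
    rw [Set.ext memL₁]
    exact (isOpen_lt continuous_const h0c).and ((isOpen_lt h0c continuous_const).and
      (isOpen_lt hdc continuous_const))
  -- (a) smoothness on the layer
  have hΨ₁s : ContMDiffOn 𝓘(ℝ, E4) (𝓡 4) ∞ Ψ₁ L₁ := by
    rw [hΨ₁]
    refine hΨ₀.comp (f := fun z : B₁.domain ↦ π (e z.1)) (fun z hz ↦ ?_) fun z hz ↦ (hmaps z hz).2
    refine ContMDiffAt.contMDiffWithinAt ?_
    rw [← ContMDiffAt.subtypeVal_comp_iff]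
    have hev : (Subtype.val ∘ fun z : B₁.domain ↦ π (e z.1)) =ᶠ[𝓝 z] fun z ↦ e z.1 := by
      filter_upwards [hL₁o.mem_nhds hz] with w hw
      rw [Function.comp_apply, hπ _ (hmaps w hw).1]
    refine ContMDiffAt.congr_of_eventuallyEq ?_ hev
    exact contMDiffAt_subtype_iff.2 (contMDiffAt_iff_contDiffAt.2 (hsmooth _ (srcL₁ z hz)))
  -- (b) open embedding of the layer: `Ψ₀|L₀ ∘ Θ` with `Θ : L₁ → L₀` induced by the bending map
  have hΨ₁e : IsOpenEmbedding (L₁.restrict Ψ₁) := by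
    have hΘ : ∀ z : L₁, π (e z.1.1) ∈ L₀ := fun z ↦ (hmaps z.1 z.2).2
    rw [show L₁.restrict Ψ₁ = L₀.restrict Ψ₀ ∘ fun z ↦ ⟨π (e z.1.1), hΘ z⟩ from
      funext fun z ↦ by rw [hΨ₁]; rfl]
    refine hΨ₀e.comp (IsOpenEmbedding.of_comp _
      (U₀.isOpen.isOpenEmbedding_subtypeVal.comp hL₀o.isOpenEmbedding_subtypeVal) ?_)
    have hj : IsOpenEmbedding fun z : L₁ ↦ (⟨z.1.1, srcL₁ z.1 z.2⟩ : e.source) :=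
      IsOpenEmbedding.of_comp _ e.open_source.isOpenEmbedding_subtypeVal
        (B₁.domain.isOpen.isOpenEmbedding_subtypeVal.comp hL₁o.isOpenEmbedding_subtypeVal)
    convert e.isOpenEmbedding_restrict.comp hj using 1
    funext z
    simp only [Function.comp_apply, restrict_apply]
    rw [hπ _ (hmaps z.1 z.2).1]
  -- (c) the layer is charted into `J⁺(ι X)`
  have hΨ₁J : Ψ₁ '' L₁ ⊆ 𝒟.metric.causalFuture 𝒟.timeOrientation (range 𝒟.embed) := by
    refine Subset.trans ?_ hΨ₀J
    rintro _ ⟨z, hz, rfl⟩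
    exact ⟨π (e z.1), (hmaps z hz).2, by rw [hΨ₁]⟩
  -- (d) the phantom layer charts the cap `Ψ₀ {t₀ = 0, M'/2 < |x̲ - ξ| < M'}` of the hyperboloid
  have hov₂' : Ψ₀ '' {x | (hypBackground U₀).time x.1 = 0 ∧ M' / 2 < r₁ x.1 ∧ r₁ x.1 < M'} ⊆
      Ψ₁ '' L₁ := by
    rintro _ ⟨x, ⟨hx0, hx1, hx2⟩, rfl⟩
    rw [hr₁'] at hx1 hx2
    rw [hypBackground_time] at hx0
    have htg : x.1 ∈ e.target := htgt x.1 hx0 hx1 hx2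
    obtain ⟨h1, h2, h3, h4⟩ := (hsrc _).1 (e.map_target htg)
    refine ⟨⟨e.symm x.1, (hB₁d _).2 h3⟩, (memL₁ _).2 ⟨h1, h2, h4⟩, ?_⟩
    rw [hΨ₁]
    dsimp only; rw [e.right_inv htg, hπ x.1 x.2]
  -- (e) the inner overlap annulus `{t* = 0, M'/2 < r ≤ M'}` of the phantom hole is empty
  have hov₁' : Ψ₁ '' {x | B₁.time x.1 = 0 ∧ M' / 2 < B₁.radius x.1 ∧ B₁.radius x.1 ≤ M'} ⊆
      Ψ₀ '' L₀ := by
    rintro _ ⟨z, hz, rfl⟩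
    exact absurd hz.2.2 (hrad z)
  -- (f) the deviation on the empty disc vanishes
  have hdev₁ : 𝒟.toSpacetime.truncDeviationCk B₁ Ψ₁ k M' 0 ≤ ε := by
    unfold Spacetime.truncDeviationCk
    rw [hT₁e, image_empty]
    simp [supCkENorm]
  /- 5. Assembly of the twenty clauses over `Fin (N + 1)`. -/
  refine ⟨Matrix.vecCons M' R, Matrix.vecCons (M' / 2) ρ, Matrix.vecCons (1, c') mo,
    Matrix.vecCons r₁ r, Matrix.vecCons B₁ B, U₀, hypBackground U₀, Fin.cases Ψ₁ Ψ, Ψ₀,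
    Fin.cases L₁ L, Fin.cases W₁ W, L₀, W₀, Fin.cases hr₁ hr, Fin.cases hB₁ hB, rfl,
    Fin.cases ⟨hL₁, hW₁⟩ hLW, hL₀, hW₀,
    Fin.cases ⟨hM', abs_zero.le.trans hM'.le, half_pos hM', half_lt_self hM'⟩ hpar,
    fun x hx ↦ hU₀ ⟨hx.1, fun i ↦ hx.2 i.succ⟩, Fin.cases ⟨hΨ₁s, hΨ₁e, hΨ₁J⟩ hΨ, hΨ₀, hΨ₀e,
    hΨ₀J, Fin.cases hdev₁ hdev, hdev₀, ?_, Fin.cases hov₁' hov₁, Fin.cases hov₂' hov₂, ?_, ?_, ?_⟩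
  · -- pairwise disjoint near zones: the phantom near zone `Ψ₁(L₁ ∩ {r ≤ M'})` is empty
    refine pairwise_disjoint_of_zero_eq_empty ?_ hdisj
    show Ψ₁ '' {x | x ∈ L₁ ∧ B₁.radius x.1 ≤ M'} = ∅
    exact image_eq_empty.2 (eq_empty_of_forall_notMem fun z hz ↦ hrad z hz.2)
  · rw [iUnion_eq_of_zero_eq_empty]
    · exact hS
    · show Ψ₁ '' B₁.truncTimeSlab M' 0 = ∅
      rw [hT₁e, image_empty]
  · rw [iUnion_eq_of_zero_eq_empty]
    · exact hWI
    · show Ψ₁ '' W₁ = ∅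
      rw [hW₁e, image_empty]
  · rw [iUnion_eq_of_zero_eq_empty]
    · exact hbar
    · show Ψ₁ '' W₁ = ∅
      rw [hW₁e, image_empty]

end Summit.FinalStateConjecture.FinalStateConjecture.Theorems.BartnikGapSettling.Capture

end
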